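import Summits.Langlands.Langlands.Theses.PhantomRMYoshida
import Summits.Langlands.Langlands.Theorems.IrreducibilityBySelfDualityEssSelfDualIrreducibleCMSchur

/-!
# Route PhantomRMYoshida — YoshidaResidualSp4Schur (item stmt-Langlands-15048)

The `GSp₄`-Schur property of the residual Yoshida type: for `p` odd, `k` algebraically closed of
characteristic `p`, and `σ̄, σ̄' : Γ_ℚ → GL₂(k)` irreducible and non-conjugate, every
`X = (A B; C D) ∈ 𝔰𝔭₄(k)` (i.e. `XᵀJ + JX = 0` for `J = J₂ ⊕ J₂`, `J₂ = (0 1; -1 0)`) commuting with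
the block-diagonal `ρ̄ = σ̄ ⊕ σ̄'` vanishes (`H⁰(Γ_ℚ, 𝔰𝔭₄(ρ̄)) = 0`).

Proof (linear algebra + Schur).  Commuting with `σ̄ ⊕ σ̄'` is blockwise
`A σ̄ = σ̄ A`, `B σ̄' = σ̄ B`, `C σ̄ = σ̄' C`, `D σ̄' = σ̄' D`.
* Schur I (`det_ne_zero_of_intertwiner`, `exists_conj_of_intertwiner`): a non-zero intertwiner
  between irreducible representations is invertible (its kernel is a stable subspace), hence
  conjugates one representation into the other; non-conjugacy forces `B = C = 0`.
* Schur II (`EssSelfDualIrreducibleCM.exists_eq_smul_one_of_forall_conj_eq`, already in the tree):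
  over algebraically closed `k` the commutant of an irreducible `GL₂`-representation is `k`, so
  `A = a • 1`, `D = d • 1`.
* Then the `(0,1)`-entries of the two diagonal blocks of `XᵀJ + JX = (2a J₂) ⊕ (2d J₂) = 0` give
  `2a = 2d = 0`, so `a = d = 0` as `2 ≠ 0` in `k` (`p ≠ 2`).
Sources: folklore (Schur's lemma); the statement is the kernel of CODIM.md §2 of the route.
-/

set_option linter.dupNamespace false -- project-wide option (lakefile weak.linter.dupNamespace); `Summit.Langlands.Langlands` is the mandated namespace
set_option autoImplicit false

namespace Summit.Langlands.Langlands.Theorems.PhantomRMYoshida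

open Matrix

section SchurI

variable {k : Type*} [Field k] {Γ : Type*} {n : ℕ}

/-- **Schur I, kernel form.** If `ρ₂ : Γ → GLₙ(k)` is irreducible (as a representation on `kⁿ`)
and `T ≠ 0` intertwines `ρ₂` into `ρ₁` (`T ρ₂(g) = ρ₁(g) T` for all `g`), then `T` is invertible:
otherwise `ker T ≠ 0` is a proper `ρ₂`-stable subspace. [folklore] -/
theorem det_ne_zero_of_intertwiner [Group Γ] (ρ₁ ρ₂ : Γ →* GL (Fin n) k)
    (hirr : Representation.IsIrreducible
      ((Representation.ofDistribMulAction k (GL (Fin n) k) (Fin n → k)).comp ρ₂))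
    {T : Matrix (Fin n) (Fin n) k} (hT : T ≠ 0)
    (h : ∀ g, T * (ρ₂ g : Matrix (Fin n) (Fin n) k) = (ρ₁ g : Matrix (Fin n) (Fin n) k) * T) :
    T.det ≠ 0 := by
  classical
  set R := (Representation.ofDistribMulAction k (GL (Fin n) k) (Fin n → k)).comp ρ₂ with hR
  have hRapply : ∀ (g : Γ) (v : Fin n → k),
      R g v = ((ρ₂ g : GL (Fin n) k) : Matrix (Fin n) (Fin n) k) *ᵥ v :=
    fun _ _ ↦ rfl
  intro hdet
  obtain ⟨v, hv0, hv⟩ := Matrix.exists_mulVec_eq_zero_iff.mpr hdet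
  -- the stable subspace `ker T`
  let W : Subrepresentation R :=
    ⟨LinearMap.ker (Matrix.toLin' T), fun g u hu ↦ by
      rw [LinearMap.mem_ker, Matrix.toLin'_apply] at hu ⊢
      rw [hRapply, Matrix.mulVec_mulVec, h g, ← Matrix.mulVec_mulVec, hu, Matrix.mulVec_zero]⟩
  have hW : ∀ u, u ∈ W.toSubmodule ↔ T *ᵥ u = 0 := fun u ↦ by
    change u ∈ LinearMap.ker (Matrix.toLin' T) ↔ _
    rw [LinearMap.mem_ker, Matrix.toLin'_apply]
  rcases hirr.eq_bot_or_eq_top W with hW' | hW'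
  · have : v ∈ W.toSubmodule := (hW v).mpr hv
    rw [hW'] at this
    exact hv0 ((Submodule.mem_bot k).mp this)
  · apply hT
    ext i j
    have hj : (Pi.single j 1 : Fin n → k) ∈ W.toSubmodule := by rw [hW']; trivial
    have := congr_fun ((hW _).mp hj) i
    rwa [Matrix.mulVec_single_one] at this

/-- **Schur I, conjugacy form.** An invertible intertwiner `T ρ₂(g) = ρ₁(g) T` conjugates `ρ₂`
into `ρ₁`: `T ρ₂(g) T⁻¹ = ρ₁(g)` in `GLₙ(k)`. [folklore] -/
theorem exists_conj_of_intertwiner (ρ₁ ρ₂ : Γ → GL (Fin n) k)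
    {T : Matrix (Fin n) (Fin n) k} (hdet : T.det ≠ 0)
    (h : ∀ g, T * (ρ₂ g : Matrix (Fin n) (Fin n) k) = (ρ₁ g : Matrix (Fin n) (Fin n) k) * T) :
    ∃ P : GL (Fin n) k, ∀ g, P * ρ₂ g * P⁻¹ = ρ₁ g := by
  classical
  obtain ⟨U, hU⟩ : IsUnit T :=
    (Matrix.isUnit_iff_isUnit_det T).mpr (isUnit_iff_ne_zero.mpr hdet)
  refine ⟨U, fun g ↦ ?_⟩
  rw [mul_inv_eq_iff_eq_mul]
  ext1
  rw [Units.val_mul, Units.val_mul, hU]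
  exact h g

end SchurI

/-- `2 ≠ 0` in a ring of prime characteristic `p ≠ 2`. [folklore] -/
theorem two_ne_zero_of_charP_ne_two (k : Type*) [Field k] (p : ℕ) [Fact p.Prime] [CharP k p]
    (hp : p ≠ 2) : (2 : k) ≠ 0 := by
  intro h
  apply hp
  have : (p : ℕ) ∣ 2 := (CharP.cast_eq_zero_iff k p 2).mp (by exact_mod_cast h)
  exact (Nat.prime_dvd_prime_iff_eq Fact.out Nat.prime_two).mp this

/-- **YoshidaResidualSp4Schur** (item stmt-Langlands-15048 of route PhantomRMYoshida): for `p`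
odd, `k` algebraically closed of characteristic `p`, `σ σ' : Γ_ℚ → GL₂(k)` irreducible and
non-conjugate, every `X = fromBlocks A B C D` with `XᵀJ + JX = 0` (`J = J₂ ⊕ J₂`) commuting with
all `σ x ⊕ σ' x` is zero.  Blockwise commutation; `B = C = 0` by Schur I and non-conjugacy;
`A = a • 1`, `D = d • 1` by Schur II; the `(0,1)` entries of the diagonal blocks of `XᵀJ + JX`
are `2a`, `2d`, whence `a = d = 0` since `2 ≠ 0`. [folklore] -/
theorem yoshidaResidualSp4Schur_proof :
    Summit.Langlands.Langlands.Theses.PhantomRMYoshida.YoshidaResidualSp4Schur := by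
  unfold Summit.Langlands.Langlands.Theses.PhantomRMYoshida.YoshidaResidualSp4Schur
  intro p _ hp k _ _ _ _ _ σ σ' hσ hσ' hnc A B C D
  dsimp only
  intro hXJ hcomm
  have h2 : (2 : k) ≠ 0 := two_ne_zero_of_charP_ne_two k p hp
  -- blockwise commutation relations
  have hblk : ∀ x, A * (σ x).val = (σ x).val * A ∧ B * (σ' x).val = (σ x).val * B ∧
      C * (σ x).val = (σ' x).val * C ∧ D * (σ' x).val = (σ' x).val * D := fun x ↦ by
    have := hcomm x
    simpa only [Matrix.fromBlocks_multiply, Matrix.mul_zero, Matrix.zero_mul, add_zero, zero_add,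
      Matrix.fromBlocks_inj] using this
  -- irreducibility in the form used by the Schur lemmas
  have hirr : Representation.IsIrreducible
      ((Representation.ofDistribMulAction k (GL (Fin 2) k) (Fin 2 → k)).comp σ.toMonoidHom) := hσ
  have hirr' : Representation.IsIrreducible
      ((Representation.ofDistribMulAction k (GL (Fin 2) k) (Fin 2 → k)).comp σ'.toMonoidHom) := hσ'
  -- Schur I: `B = 0`
  have hB0 : B = 0 := by
    by_contra hB
    have hdet := det_ne_zero_of_intertwiner σ.toMonoidHom σ'.toMonoidHom hirr' hB
      (fun x ↦ (hblk x).2.1)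
    obtain ⟨P, hP⟩ := exists_conj_of_intertwiner (fun x ↦ σ x) (fun x ↦ σ' x) hdet
      (fun x ↦ (hblk x).2.1)
    exact hnc ⟨P⁻¹, fun x ↦ by rw [← hP x]; group⟩
  -- Schur I: `C = 0`
  have hC0 : C = 0 := by
    by_contra hC
    have hdet := det_ne_zero_of_intertwiner σ'.toMonoidHom σ.toMonoidHom hirr hC
      (fun x ↦ (hblk x).2.2.1)
    obtain ⟨P, hP⟩ := exists_conj_of_intertwiner (fun x ↦ σ' x) (fun x ↦ σ x) hdet
      (fun x ↦ (hblk x).2.2.1)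
    exact hnc ⟨P, hP⟩
  -- Schur II: `A`, `D` scalar
  obtain ⟨a, ha⟩ := EssSelfDualIrreducibleCM.exists_eq_smul_one_of_forall_conj_eq σ.toMonoidHom
    hirr (T := A) (fun x ↦ by
      change (σ x : Matrix (Fin 2) (Fin 2) k) * A * ((σ x)⁻¹ : GL (Fin 2) k) = A
      rw [← (hblk x).1, Matrix.mul_assoc, Units.mul_inv, Matrix.mul_one])
  obtain ⟨d, hd⟩ := EssSelfDualIrreducibleCM.exists_eq_smul_one_of_forall_conj_eq σ'.toMonoidHom
    hirr' (T := D) (fun x ↦ by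
      change (σ' x : Matrix (Fin 2) (Fin 2) k) * D * ((σ' x)⁻¹ : GL (Fin 2) k) = D
      rw [← (hblk x).2.2.2, Matrix.mul_assoc, Units.mul_inv, Matrix.mul_one])
  subst hB0 hC0 ha hd
  -- the symplectic condition at the `(0,1)` entries of the two diagonal blocks
  have ha0 := congr_fun (congr_fun hXJ (Sum.inl 0)) (Sum.inl 1)
  have hd0 := congr_fun (congr_fun hXJ (Sum.inr 0)) (Sum.inr 1)
  simp only [Fin.isValue, Matrix.add_apply, Matrix.mul_apply, transpose_apply, Fintype.sum_sum_type,
    fromBlocks_apply₁₁, Matrix.smul_apply, Matrix.one_apply, smul_eq_mul, mul_ite, mul_one, mul_zero, of_apply,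
    cons_val', cons_val_one, cons_val_fin_one, ite_mul, zero_mul, Finset.sum_ite_eq', Finset.mem_univ, ↓reduceIte,
    cons_val_zero, fromBlocks_apply₂₁, Matrix.zero_apply, Finset.sum_const_zero, add_zero, one_mul, fromBlocks_apply₁₂,
    fromBlocks_apply₂₂, zero_add] at ha0 hd0
  have ha' : a = 0 := by
    rcases mul_eq_zero.mp (show (2 : k) * a = 0 by rw [two_mul]; exact ha0) with h | h
    · exact absurd h h2
    · exact h
  have hd' : d = 0 := by
    rcases mul_eq_zero.mp (show (2 : k) * d = 0 by rw [two_mul]; exact hd0) with h | h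
    · exact absurd h h2
    · exact h
  subst ha' hd'
  simp [Matrix.fromBlocks_zero]

end Summit.Langlands.Langlands.Theorems.PhantomRMYoshida
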